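import Mathlib
import Summits.Ventures.PercRepro2.SepFarAnyGen

/-!
# Gluing at a general separator, IV: ANY split of the five marks across a separator `σ : ι → V`
— the side data, the glued state and the typed identity (blind cell PercRepro2, mine-2 g48,
2026-08-29; `conjectures/MINE-2.md` M2-98)

The five marks are a vector `mk : Fin 5 → V` (`0 = o, 1 = a₁, 2 = a₂, 3 = a₃, 4 = b`) and a SIDE
assignment `side : Fin 5 → Bool` sends each mark to the far side `VL` (`true`) or to the root side
`VH` (`false`).  CLASS (`SepSplit`): the support graph `z ∪ F` splits into the two sides, their
intersection covered by the separator vertices, no typed edge inside both sides, the far-side marks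
off the separator (a mark that is a separator vertex is a root-side mark).  Each side contributes
the SAME kind of data — the connections inside the side among the marks, from the separator
vertices to the marks, and among the separator vertices (`SideData`, read by `sideData` on the
side's restriction) — and the two data determine every copy's state (`st_eq_gluedS`): two marks on
one side are joined inside that side or through a glued pair of separator vertices, a root-side
mark reaches a far-side mark through a glued pair (`conn_iff_connS`, by `conn_sideG` on either
side and `conn_crossG`; the glue relation is symmetric in the two sides, `glue_comm`).  Sorting
the copies by their far-side data triple gives the identity `typedCount_eq_sepSplit`:
`typedCount F z τ K₃ = (Σ_p farCount(p) · rootCount(p)) · (inert count)`, for EVERY split — one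
far mark (`SepFarAnyGen`, the case `side = (· = far)`, `sepSplit_of_sepFarAny`), two far marks,
three, four.  The rule on the realised orbits is in `SepSplitRule`.  Own work; standard axioms.
-/

namespace Summit.Ventures.PercRepro2

open UnionCluster

namespace CovForm

namespace RootBridge

open OneTyped TypedA3 Untouched TypedFactor Separated

/-! ## The glue relation is symmetric in the two sides -/

section Comm

open Classical

variable {V : Type*} {E : Type*} {ι : Type*} (ends : E → Sym2 V)

/-- A step of the glue relation does not depend on the order of the sides. -/
lemma sepStep_comm (W W' : Set V) (σ : ι → V) (x : Config E) (i j : ι) :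
    sepStep ends W W' σ x i j ↔ sepStep ends W' W σ x i j := by
  unfold sepStep
  exact Or.comm

/-- The glue relation does not depend on the order of the sides. -/
lemma glue_comm (W W' : Set V) (σ : ι → V) (x : Config E) (i j : ι) :
    glue ends W W' σ x i j ↔ glue ends W' W σ x i j := by
  have hrel : sepStep ends W W' σ x = sepStep ends W' W σ x := by
    funext i j
    exact propext (sepStep_comm ends W W' σ x i j)
  unfold glue
  rw [hrel]

end Comm

/-! ## The side data and the glued state -/

section States

open Classical

variable {ι : Type*}

/-- The data of one side of a copy at a separator indexed by `ι`, for the five marks `Fin 5`: the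
connections inside the side among the marks, from the separator vertices to the marks, and among
the separator vertices (entries of marks on the other side are never read). -/
abbrev SideData (ι : Type*) := (Fin 5 → Fin 5 → Bool) × (ι → Fin 5 → Bool) × (ι → ι → Bool)

/-- The glue relation read off the two side data: the closure of «joined inside the root side or
inside the far side». -/
def glueDS (h p : SideData ι) (i j : ι) : Prop :=
  Relation.ReflTransGen (fun i j => h.2.2 i j = true ∨ p.2.2 i j = true) i j

/-- **The glued connection** between the marks `k` and `l` from the root-side data `h`, the far-side
data `p` and the side assignment: inside a common side, directly or through a glued pair of
separator vertices; across the separator, from the root-side mark through a glued pair to the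
far-side mark. -/
def connS (h p : SideData ι) (side : Fin 5 → Bool) (k l : Fin 5) : Prop :=
  if side k = true then
    (if side l = true then
      p.1 k l = true ∨ ∃ i j, p.2.1 i k = true ∧ glueDS h p i j ∧ p.2.1 j l = true
    else ∃ i j, h.2.1 i l = true ∧ glueDS h p i j ∧ p.2.1 j k = true)
  else
    (if side l = true then ∃ i j, h.2.1 i k = true ∧ glueDS h p i j ∧ p.2.1 j l = true
    else h.1 k l = true ∨ ∃ i j, h.2.1 i k = true ∧ glueDS h p i j ∧ h.2.1 j l = true)

/-- **The glued state**: the seven kernel coordinates `(a₂a₁, a₁o, a₂o, a₁b, a₂b, a₁a₃, a₂a₃)`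
read through the glued connection. -/
noncomputable def gluedS (h p : SideData ι) (side : Fin 5 → Bool) : St :=
  (decide (connS h p side 2 1), decide (connS h p side 1 0), decide (connS h p side 2 0),
    decide (connS h p side 1 4), decide (connS h p side 2 4), decide (connS h p side 1 3),
    decide (connS h p side 2 3))

/-- The exact-pattern indicator on side data. -/
noncomputable def exactS (p q : SideData ι) : ℤ := if p = q then 1 else 0

/-- The indicator is nonnegative. -/
lemma exactS_nonneg (p q : SideData ι) : 0 ≤ exactS p q := by
  unfold exactS
  split_ifs <;> simp

/-- A far-side data triple (one per copy). -/
abbrev Pat3S (ι : Type*) := SideData ι × SideData ι × SideData ι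

/-- Summing a function against the exact indicators of a data triple picks the triple. -/
lemma sum_exactS [Fintype ι] [DecidableEq ι] (f : Pat3S ι → ℤ) (q : Pat3S ι) :
    (∑ p : Pat3S ι, exactS p.1 q.1 * exactS p.2.1 q.2.1 * exactS p.2.2 q.2.2 * f p) = f q := by
  rw [Finset.sum_eq_single q]
  · simp [exactS]
  · intro p _ hpq
    by_cases h1 : p.1 = q.1
    · by_cases h2 : p.2.1 = q.2.1
      · by_cases h3 : p.2.2 = q.2.2
        · exact absurd (Prod.ext h1 (Prod.ext h2 h3)) hpq
        · simp [exactS, h3]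
      · simp [exactS, h2]
    · simp [exactS, h1]
  · intro h
    exact absurd (Finset.mem_univ q) h

end States

/-! ## The class, the states of the support and the identity -/

section Main

open Classical

variable {V : Type*} {E : Type*} {ι : Type*} [Fintype E] [DecidableEq E] {R : Type*} [Field R]
  [LinearOrder R] [IsStrictOrderedRing R]
variable (ends : E → Sym2 V) (mk : Fin 5 → V) (σ : ι → V)

/-- The side data of a configuration (read on a side's restriction). -/
noncomputable def sideData (y : Config E) : SideData ι :=
  (fun k l => decide (Conn ends y (mk k) (mk l)), fun i k => decide (Conn ends y (σ i) (mk k)),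
    fun i j => decide (Conn ends y (σ i) (σ j)))

/-- **The marks split across the separator `σ`**: the support graph `z ∪ F` splits into a root
side `VH` holding the marks with `side k = false` and a far side `VL` holding the marks with
`side k = true`, the intersection covered by the separator vertices, no typed edge inside both
sides, the far-side marks not separator vertices. -/
structure SepSplit (side : Fin 5 → Bool) (VL VH : Set V) (F : Finset E) (z : Config E) :
    Prop where
  split : ∀ e, zF F z e = true → e ∈ within ends VL ∨ e ∈ within ends VH
  cap : ∀ t, t ∈ VL → t ∈ VH → ∃ i, σ i = t
  noloop : ∀ e ∈ F, ¬ (e ∈ within ends VL ∧ e ∈ within ends VH)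
  rootH : ∀ k, side k = false → mk k ∈ VH
  farL : ∀ k, side k = true → mk k ∈ VL
  farsep : ∀ k, side k = true → ∀ i, σ i ≠ mk k

omit [Fintype E] [LinearOrder R] [IsStrictOrderedRing R] in
/-- One mark alone behind the separator is the split `side = (· = far)`. -/
lemma sepSplit_of_sepFarAny {far : Fin 5} {VL VH : Set V} {F : Finset E} {z : Config E}
    (h : SepFarAny ends mk σ far VL VH F z) :
    SepSplit ends mk σ (fun k => decide (k = far)) VL VH F z where
  split := h.split
  cap := h.cap
  noloop := h.noloop
  rootH := fun k hk => h.rootH k (by simpa using hk)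
  farL := fun k hk => by
    have : k = far := by simpa using hk
    subst this
    exact h.farL
  farsep := fun k hk => by
    have : k = far := by simpa using hk
    subst this
    exact h.farsep

omit [Fintype E] [LinearOrder R] [IsStrictOrderedRing R] in
/-- A configuration below `z ∪ F` has its open edges within a side. -/
lemma SepSplit.split_of_le {side : Fin 5 → Bool} {VL VH : Set V} {F : Finset E} {z : Config E}
    (h : SepSplit ends mk σ side VL VH F z) {x : Config E} (hx : x ≤ zF F z) :
    ∀ e, x e = true → e ∈ within ends VL ∨ e ∈ within ends VH := fun e he =>
  h.split e (by have := hx e; rw [he] at this; exact Bool.eq_true_of_true_le this)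

omit [Fintype E] [DecidableEq E] [LinearOrder R] [IsStrictOrderedRing R] in
/-- The glue relation of the sides is the glue relation of the two side data. -/
lemma glue_iff_glueDS (VL VH : Set V) (x : Config E) (i j : ι) :
    glue ends VH VL σ x i j ↔
      glueDS (sideData ends mk σ (withinRestr ends VH x))
        (sideData ends mk σ (withinRestr ends VL x)) i j := by
  unfold glue glueDS
  have hrel : sepStep ends VH VL σ x = fun i j =>
      (sideData ends mk σ (withinRestr ends VH x)).2.2 i j = true ∨
        (sideData ends mk σ (withinRestr ends VL x)).2.2 i j = true := by
    funext i j
    simp only [sepStep, sideData, decide_eq_true_eq]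
  rw [hrel]

omit [Fintype E] [LinearOrder R] [IsStrictOrderedRing R] in
/-- **The glued connection is the connection**: for two distinct marks, the connection in a copy
of the support is the glued connection of its two side data. -/
theorem conn_iff_connS {side : Fin 5 → Bool} {VL VH : Set V} {F : Finset E} {z : Config E}
    (h : SepSplit ends mk σ side VL VH F z) {x : Config E} (hx : ∀ e, e ∉ F → x e = z e)
    (k l : Fin 5) :
    Conn ends x (mk k) (mk l) ↔
      connS (sideData ends mk σ (withinRestr ends VH x))
        (sideData ends mk σ (withinRestr ends VL x)) side k l := by
  have hsp := SepSplit.split_of_le ends mk σ h (le_zF hx)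
  have hsp' : ∀ e, x e = true → e ∈ within ends VH ∨ e ∈ within ends VL := fun e he =>
    (hsp e he).symm
  have hcap' : ∀ t, t ∈ VH → t ∈ VL → ∃ i, σ i = t := fun t h1 h2 => h.cap t h2 h1
  have hg := glue_iff_glueDS ends mk σ VL VH x
  have hg' : ∀ i j, glue ends VL VH σ x i j ↔
      glueDS (sideData ends mk σ (withinRestr ends VH x))
        (sideData ends mk σ (withinRestr ends VL x)) i j := fun i j => by
    rw [glue_comm]
    exact hg i j
  unfold connS
  by_cases hk : side k = true
  · rw [if_pos hk]
    by_cases hl : side l = true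
    · rw [if_pos hl]
      rw [conn_sideG ends hsp h.cap (h.farL k hk) (h.farL l hl)]
      simp only [reachG, hg', sideData, decide_eq_true_eq]
    · rw [if_neg hl]
      have hl' : side l = false := by simpa using hl
      have e0 : Conn ends x (mk k) (mk l) ↔ Conn ends x (mk l) (mk k) := ⟨conn_symm, conn_symm⟩
      rw [e0, conn_crossG ends hsp' hcap' (h.rootH l hl') (h.farL k hk) (h.farsep k hk)]
      simp only [reachG', hg, sideData, decide_eq_true_eq]
  · rw [if_neg hk]
    have hk' : side k = false := by simpa using hk
    by_cases hl : side l = true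
    · rw [if_pos hl]
      rw [conn_crossG ends hsp' hcap' (h.rootH k hk') (h.farL l hl) (h.farsep l hl)]
      simp only [reachG', hg, sideData, decide_eq_true_eq]
    · rw [if_neg hl]
      have hl' : side l = false := by simpa using hl
      rw [conn_sideG ends hsp' hcap' (h.rootH k hk') (h.rootH l hl')]
      simp only [reachG, hg, sideData, decide_eq_true_eq]

omit [Fintype E] [LinearOrder R] [IsStrictOrderedRing R] in
/-- **The state of a copy of the support**: the root-side data glued with the far-side data. -/
theorem st_eq_gluedS {side : Fin 5 → Bool} {VL VH : Set V} {F : Finset E} {z : Config E}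
    (h : SepSplit ends mk σ side VL VH F z) {x : Config E} (hx : ∀ e, e ∉ F → x e = z e) :
    st ends (mk 0) (mk 1) (mk 2) (mk 3) (mk 4) x =
      gluedS (sideData ends mk σ (withinRestr ends VH x))
        (sideData ends mk σ (withinRestr ends VL x)) side := by
  unfold st gluedS
  rw [decide_eq_decide.mpr (conn_iff_connS ends mk σ h hx 2 1),
    decide_eq_decide.mpr (conn_iff_connS ends mk σ h hx 1 0),
    decide_eq_decide.mpr (conn_iff_connS ends mk σ h hx 2 0),
    decide_eq_decide.mpr (conn_iff_connS ends mk σ h hx 1 4),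
    decide_eq_decide.mpr (conn_iff_connS ends mk σ h hx 2 4),
    decide_eq_decide.mpr (conn_iff_connS ends mk σ h hx 1 3),
    decide_eq_decide.mpr (conn_iff_connS ends mk σ h hx 2 3)]

/-- The far-side kernel of the exact data triple `p`: each copy's far-side data, read on the
restriction to `VL`, must be the prescribed one. -/
noncomputable def farKS (VL : Set V) (p : Pat3S ι) : Config E → Config E → Config E → R :=
  fun x y w => ((exactS p.1 (sideData ends mk σ (withinRestr ends VL x)) *
    exactS p.2.1 (sideData ends mk σ (withinRestr ends VL y)) *
    exactS p.2.2 (sideData ends mk σ (withinRestr ends VL w)) : ℤ) : R)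

/-- The root-side kernel of a fixed far-side data triple `p`: the kernel on the glued states of
the three copies, read on the root-side restriction. -/
noncomputable def rootKS (side : Fin 5 → Bool) (VH : Set V) (p : Pat3S ι) :
    Config E → Config E → Config E → R :=
  fun x y w => ((KB (gluedS (sideData ends mk σ (withinRestr ends VH x)) p.1 side)
    (gluedS (sideData ends mk σ (withinRestr ends VH y)) p.2.1 side)
    (gluedS (sideData ends mk σ (withinRestr ends VH w)) p.2.2 side) : ℤ) : R)

omit [Fintype E] [LinearOrder R] [IsStrictOrderedRing R] in
/-- **`K₃` on the support** for a split of the marks across the separator: the data-triple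
form. -/
theorem K3_eq_sepSplit [Fintype ι] [DecidableEq ι] {side : Fin 5 → Bool} {VL VH : Set V}
    {F : Finset E} {z : Config E} (h : SepSplit ends mk σ side VL VH F z) {x y w : Config E}
    (hx : ∀ e, e ∉ F → x e = z e) (hy : ∀ e, e ∉ F → y e = z e) (hw : ∀ e, e ∉ F → w e = z e) :
    (K3 ends (mk 0) (mk 1) (mk 2) (mk 3) (mk 4) x y w : R) =
      ∑ p : Pat3S ι, farKS ends mk σ VL p (restr (sideF ends VL F) z x)
          (restr (sideF ends VL F) z y) (restr (sideF ends VL F) z w) *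
        rootKS ends mk σ side VH p (restr (sideF ends VH F) z x) (restr (sideF ends VH F) z y)
          (restr (sideF ends VH F) z w) := by
  rw [K3_eq_KB, st_eq_gluedS ends mk σ h hx, st_eq_gluedS ends mk σ h hy,
    st_eq_gluedS ends mk σ h hw]
  unfold farKS rootKS
  rw [withinRestr_restr_eq ends VH hx, withinRestr_restr_eq ends VH hy,
    withinRestr_restr_eq ends VH hw, withinRestr_restr_eq ends VL hx,
    withinRestr_restr_eq ends VL hy, withinRestr_restr_eq ends VL hw]
  set hx' := sideData ends mk σ (withinRestr ends VH x) with hhx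
  set hy' := sideData ends mk σ (withinRestr ends VH y) with hhy
  set hw' := sideData ends mk σ (withinRestr ends VH w) with hhw
  set qx := sideData ends mk σ (withinRestr ends VL x) with hqx
  set qy := sideData ends mk σ (withinRestr ends VL y) with hqy
  set qw := sideData ends mk σ (withinRestr ends VL w) with hqw
  have hs : (∑ p : Pat3S ι, exactS p.1 qx * exactS p.2.1 qy * exactS p.2.2 qw *
      KB (gluedS hx' p.1 side) (gluedS hy' p.2.1 side) (gluedS hw' p.2.2 side)) =
      KB (gluedS hx' qx side) (gluedS hy' qy side) (gluedS hw' qw side) :=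
    sum_exactS (fun p : Pat3S ι => KB (gluedS hx' p.1 side) (gluedS hy' p.2.1 side)
      (gluedS hw' p.2.2 side)) (qx, qy, qw)
  rw [← hs]
  push_cast
  rfl

omit [LinearOrder R] [IsStrictOrderedRing R] in
/-- **THE TYPED IDENTITY AT A SEPARATOR OF ANY SIZE, FOR ANY SPLIT OF THE MARKS**: sorting the
copies by their far-side data triple,
`typedCount F z τ K₃ = (Σ_p farCount(p) · rootCount(p)) · (inert count)`. -/
theorem typedCount_eq_sepSplit [Fintype ι] [DecidableEq ι] {side : Fin 5 → Bool}
    {VL VH : Set V} (F : Finset E) (z : Config E) (τ : E → ℕ)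
    (h : SepSplit ends mk σ side VL VH F z) :
    typedCount F z τ
        (K3 ends (mk 0) (mk 1) (mk 2) (mk 3) (mk 4) : Config E → Config E → Config E → R) =
      (∑ p : Pat3S ι, typedCount (sideF ends VL F) z τ (farKS ends mk σ VL p) *
          typedCount (sideF ends VH F) z τ (rootKS ends mk σ side VH p)) *
        typedCount (F \ (sideF ends VL F ∪ sideF ends VH F)) z τ (fun _ _ _ => (1 : R)) := by
  set A := sideF ends VL F with hA
  set B := sideF ends VH F with hB
  set C := F \ (A ∪ B) with hC
  have hAF : A ⊆ F := Finset.filter_subset _ _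
  have hBF : B ⊆ F := Finset.filter_subset _ _
  have hAB : Disjoint A B := by
    rw [Finset.disjoint_left]
    intro e heA heB
    simp only [hA, hB, sideF, Finset.mem_filter] at heA heB
    exact h.noloop e heA.1 ⟨heA.2, heB.2⟩
  have hABF : A ∪ B ⊆ F := Finset.union_subset hAF hBF
  have hAC : Disjoint A C :=
    Finset.disjoint_of_subset_left Finset.subset_union_left Finset.disjoint_sdiff
  have hBC : Disjoint B C :=
    Finset.disjoint_of_subset_left Finset.subset_union_right Finset.disjoint_sdiff
  have hF : A ∪ B ∪ C = F := Finset.union_sdiff_of_subset hABF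
  have hker : typedCount F z τ
      (K3 ends (mk 0) (mk 1) (mk 2) (mk 3) (mk 4) : Config E → Config E → Config E → R) =
      typedCount F z τ (fun x y w => ∑ p : Pat3S ι,
        farKS ends mk σ VL p (restr A z x) (restr A z y) (restr A z w) *
          rootKS ends mk σ side VH p (restr B z x) (restr B z y) (restr B z w)) := by
    refine typedCount_congr_on_support F z τ fun x y w hc _ => ?_
    exact K3_eq_sepSplit ends mk σ h (fun e he => (hc e he).1)
      (fun e he => (hc e he).2.1) (fun e he => (hc e he).2.2)
  have hm : ∀ p : Pat3S ι, typedCount (A ∪ B ∪ C) z τ (fun x y w =>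
      farKS ends mk σ VL p (restr A z x) (restr A z y) (restr A z w) *
        rootKS ends mk σ side VH p (restr B z x) (restr B z y) (restr B z w)) =
      typedCount A z τ (farKS ends mk σ VL p) *
        typedCount B z τ (rootKS ends mk σ side VH p) *
        typedCount C z τ (fun _ _ _ => (1 : R)) := fun p =>
    typedCount_mul_three A B C hAB hAC hBC z τ (farKS ends mk σ VL p)
      (rootKS ends mk σ side VH p : Config E → Config E → Config E → R)
  rw [hF] at hm
  rw [hker, typedCount_sum, Finset.sum_congr rfl (fun p _ => hm p), Finset.sum_mul]

end Main

end RootBridge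

end CovForm

end Summit.Ventures.PercRepro2
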